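import Mathlib
import Literature.NumberTheory.Sieve.VinogradovExpSumTools
import Literature.NumberTheory.LFunctions.VanDerCorputZeta
import HarnessLib

/-!
# Teräväinen 2024, §5.3: near-extremal exponential averages concentrate the phase

Support file (everything PROVED; no definitions, no named facts) towards the named fact
`Literature.NumberTheory.Sieve.teravainen2024_cor_2_1` (J. Teräväinen, *On the Liouville function
at polynomial arguments*, Amer. J. Math. 146 (2024) = arXiv:2010.07924, Corollary 2.1 ⊂
Theorem 2.6 for `g_j = λ`, proved in §5). In the proof of Proposition 5.3 (§5.3, p. 12, the
case `σ(d) ≡ 1`), writing the unimodular functions as `f_j = e(F_j)`, the hypothesis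
`𝔼_{d} 𝔼_{n} f_1(n + dh_1) ⋯ f_k(n + dh_k) ≥ 1 - η` is converted into

> **(5.25)** `𝔼_{d} 𝔼_{n} ‖F_1(n + dh_1) + ⋯ + F_k(n + dh_k) - α‖ ≤ 10 η^{1/2}` for some `α ∈ ℝ`
> ("applying Markov's inequality and the Taylor approximation of the exponential function").

This file proves the underlying general fact: if a finite family of phases `G_i` has
`|∑_{i ∈ S} e(G_i)| ≥ (1 - η) #S`, then for a suitable `α` (the argument of the sum),
`∑_{i ∈ S} ‖G_i - α‖_{ℝ/ℤ} ≤ η^{1/2} #S`. The proof: rotate by `α`, so that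
`∑ (1 - cos 2π(G_i - α)) ≤ η #S`; `1 - cos 2πt = 2 sin²(πt) ≥ 8 ‖t‖²` (Jordan's inequality);
Cauchy–Schwarz.

* `Teravainen2024.eight_mul_distInt_sq_le` — `8 ‖t‖² ≤ 1 - cos(2πt)`;
* `Teravainen2024.exists_shift_sum_distInt_le` — the statement above.

## References
* J. Teräväinen, Amer. J. Math. 146 (2024), §5.3, proof of Proposition 5.3, (5.25) (p. 12),
  arXiv:2010.07924. [Teravainen2024]
-/

noncomputable section

open Finset Complex

namespace Literature.NumberTheory.Sieve

namespace Teravainen2024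

open Literature.NumberTheory.LFunctions Literature.NumberTheory.Sieve.Vinogradov

/-- **Jordan-type bound for the cosine defect**: `8 ‖t‖² ≤ 1 - cos(2πt)` where `‖t‖` is the
distance to the nearest integer. [folklore] -/
theorem eight_mul_distInt_sq_le (t : ℝ) : 8 * distInt t ^ 2 ≤ 1 - Real.cos (2 * Real.pi * t) := by
  set s : ℝ := t - round t with hs
  have hsabs : |s| ≤ 1 / 2 := abs_sub_round t
  have hdist : distInt t = |s| := rfl
  -- `cos(2πt) = cos(2πs)`
  have hcos : Real.cos (2 * Real.pi * t) = Real.cos (2 * Real.pi * s) := by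
    have : 2 * Real.pi * t = 2 * Real.pi * s + (round t : ℤ) * (2 * Real.pi) := by rw [hs]; ring
    rw [this, Real.cos_add_int_mul_two_pi]
  rw [hcos, hdist]
  -- `1 - cos(2πs) = 2 sin²(πs)` and `|sin(πs)| ≥ 2|s|`
  have h1 : 1 - Real.cos (2 * Real.pi * s) = 2 * Real.sin (Real.pi * s) ^ 2 := by
    rw [show 2 * Real.pi * s = 2 * (Real.pi * s) by ring, Real.cos_two_mul]
    nlinarith [Real.sin_sq_add_cos_sq (Real.pi * s)]
  rw [h1]
  have h2 : 2 * |s| ≤ |Real.sin (Real.pi * s)| := by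
    have hπ := Real.pi_pos
    have hx0 : 0 ≤ Real.pi * |s| := by positivity
    have hx1 : Real.pi * |s| ≤ Real.pi / 2 := by nlinarith
    have hj := Real.mul_le_sin hx0 hx1
    have e1 : 2 / Real.pi * (Real.pi * |s|) = 2 * |s| := by field_simp
    rw [e1] at hj
    have hsle : s ≤ 1 / 2 := le_trans (le_abs_self s) hsabs
    have hsge : -(1 / 2) ≤ s := by linarith [neg_abs_le s]
    have e2 : Real.sin (Real.pi * |s|) = |Real.sin (Real.pi * s)| := by
      rcases le_or_gt 0 s with hs0 | hs0
      · rw [abs_of_nonneg hs0]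
        rw [abs_of_nonneg (Real.sin_nonneg_of_nonneg_of_le_pi (by positivity) (by nlinarith))]
      · have hle : Real.sin (Real.pi * s) ≤ 0 :=
          Real.sin_nonpos_of_nonpos_of_neg_pi_le (by nlinarith) (by nlinarith)
        rw [abs_of_neg hs0, mul_neg, Real.sin_neg, abs_of_nonpos hle]
    linarith [e2 ▸ hj]
  nlinarith [sq_nonneg (|Real.sin (Real.pi * s)| - 2 * |s|), sq_abs (Real.sin (Real.pi * s)), sq_abs s,
    abs_nonneg s]

/-- The real part of `e(x)`. [folklore] -/
theorem e_re (x : ℝ) : (VdC.e x).re = Real.cos (2 * Real.pi * x) := by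
  unfold VdC.e
  rw [Complex.exp_ofReal_mul_I_re]

/-- **Near-extremal exponential sums concentrate the phases** (the "Markov + Taylor" step (5.25)
of the proof of Proposition 5.3): if `(1 - η) #S ≤ |∑_{i∈S} e(G_i)|` then for some real `α`,
`∑_{i∈S} ‖G_i - α‖_{ℝ/ℤ} ≤ η^{1/2} #S`. [cite: Teravainen2024, §5.3, (5.25) (p. 12)] -/
theorem exists_shift_sum_distInt_le {ι : Type*} (S : Finset ι) (G : ι → ℝ) {η : ℝ} (hη : 0 ≤ η)
    (h : (1 - η) * #S ≤ ‖∑ i ∈ S, VdC.e (G i)‖) :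
    ∃ α : ℝ, ∑ i ∈ S, distInt (G i - α) ≤ Real.sqrt η * #S := by
  have hS0 : (0 : ℝ) ≤ #S := by positivity
  -- trivial when `η ≥ 1/4` hmm: we treat `η ≥ 1` separately (then `√η #S ≥ #S/2 ≥ ∑ distInt`)
  by_cases hη1 : 1 ≤ η
  · refine ⟨0, ?_⟩
    calc ∑ i ∈ S, distInt (G i - 0) ≤ ∑ _i ∈ S, (1 / 2 : ℝ) := Finset.sum_le_sum fun i _ => distInt_le_half _
      _ = 1 / 2 * #S := by rw [Finset.sum_const, nsmul_eq_mul, mul_comm]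
      _ ≤ Real.sqrt η * #S := by
          apply mul_le_mul_of_nonneg_right _ hS0
          have : (1 : ℝ) ≤ Real.sqrt η := by rw [Real.le_sqrt (by norm_num) hη]; linarith
          linarith
  push Not at hη1
  set Z : ℂ := ∑ i ∈ S, VdC.e (G i) with hZ
  by_cases hZ0 : Z = 0
  · -- then `(1-η)#S ≤ 0`, so `S = ∅` (as `η < 1`)
    rw [hZ0, norm_zero] at h
    have hS : (#S : ℝ) = 0 := by nlinarith
    refine ⟨0, ?_⟩
    have : S = ∅ := Finset.card_eq_zero.mp (by exact_mod_cast hS)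
    rw [this]; simp
  -- rotate by `α = arg Z / (2π)`
  set α : ℝ := Complex.arg Z / (2 * Real.pi) with hα
  have hrot : VdC.e (-α) * Z = (‖Z‖ : ℂ) := by
    have hαπ : 2 * Real.pi * -α = -Complex.arg Z := by
      rw [hα, mul_neg, mul_div_cancel₀ _ (by positivity : (2 * Real.pi) ≠ 0)]
    have h1 : VdC.e (-α) = Complex.exp (-(Complex.arg Z) * Complex.I) := by
      unfold VdC.e; rw [hαπ]; push_cast; ring_nf
    rw [h1]
    conv_lhs => rw [← Complex.norm_mul_exp_arg_mul_I Z]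
    rw [← mul_assoc, mul_comm (Complex.exp _), mul_assoc, ← Complex.exp_add]
    simp
  -- `∑ cos(2π(G_i - α)) = ‖Z‖ ≥ (1-η)#S`
  have hre : ∑ i ∈ S, Real.cos (2 * Real.pi * (G i - α)) = ‖Z‖ := by
    have h1 : ∑ i ∈ S, Real.cos (2 * Real.pi * (G i - α)) = (VdC.e (-α) * Z).re := by
      rw [hZ, Finset.mul_sum, Complex.re_sum]
      refine Finset.sum_congr rfl fun i _ => ?_
      rw [← VdC.e_add, ← e_re]; ring_nf
    rw [h1, hrot, Complex.ofReal_re]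
  have hdef : ∑ i ∈ S, (1 - Real.cos (2 * Real.pi * (G i - α))) ≤ η * #S := by
    rw [Finset.sum_sub_distrib, Finset.sum_const, nsmul_eq_mul, mul_one, hre]
    linarith
  -- `∑ ‖G_i - α‖² ≤ η #S / 8`
  have hsq : ∑ i ∈ S, distInt (G i - α) ^ 2 ≤ η * #S / 8 := by
    have : ∑ i ∈ S, 8 * distInt (G i - α) ^ 2 ≤ η * #S :=
      (Finset.sum_le_sum fun i _ => eight_mul_distInt_sq_le (G i - α)).trans hdef
    rw [← Finset.mul_sum] at this
    linarith
  refine ⟨α, ?_⟩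
  -- Cauchy–Schwarz
  have hcs := Real.sum_mul_le_sqrt_mul_sqrt S (fun _ => (1 : ℝ)) (fun i => distInt (G i - α))
  simp only [one_mul, one_pow, Finset.sum_const, nsmul_eq_mul, mul_one] at hcs
  refine hcs.trans ?_
  calc Real.sqrt #S * Real.sqrt (∑ i ∈ S, distInt (G i - α) ^ 2)
      ≤ Real.sqrt #S * Real.sqrt (η * #S / 8) :=
        mul_le_mul_of_nonneg_left (Real.sqrt_le_sqrt hsq) (Real.sqrt_nonneg _)
    _ ≤ Real.sqrt #S * Real.sqrt (η * #S) := by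
        apply mul_le_mul_of_nonneg_left _ (Real.sqrt_nonneg _)
        exact Real.sqrt_le_sqrt (by nlinarith)
    _ = Real.sqrt η * #S := by
        rw [Real.sqrt_mul hη, ← mul_assoc, mul_comm (Real.sqrt #S), mul_assoc, Real.mul_self_sqrt hS0]

end Teravainen2024

end Literature.NumberTheory.Sieve
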